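import Summits.NavierStokesRegularity.NavierStokesRegularity.Theorems.EfficiencyFloorProductionEfficiencyDecayDssStratumRung
import HarnessLib

/-!
# Crux `EfficiencyFloor.ProductionEfficiencyDecay` (stmt-NavierStokesRegularity-22866): the DSS exclusion behind the
# landed BC5 rung is ROBUST — it needs discrete self-similarity only on the past WINDOW `[T − T/c², T)`

`--supports stmt-NavierStokesRegularity-22866 --as helper` (line `efficiency_floor`; seat ns-ef-p3).

The registered stub `stub_dssStratumRung` was closed (p591554) because its hypothesis class — maximal smooth
Leray–Hopf rapidly-decaying-datum solutions with `IsDiscretelySelfSimilar c (fun s x => u (T + s) x)` — is EMPTY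
(`ProductionEfficiencyDecay.not_dssLerayHopfBlowup`). The tree's `IsDiscretelySelfSimilar` imposes the scaling relation
`c • u(T + c²s, c x) = u(T + s, x)` at ALL `s`, including times outside the life span `[0,T)` where `u` is junk, so a
critic may ask whether the emptiness is an artefact of that convention. It is not: this file proves the exclusion from
the PHYSICAL hypothesis alone — the relation only for `s ∈ [−T/c², 0)`, i.e. exactly the pairs of times
`T + s, T + c²s` that both lie in `[0,T)` (`not_windowedDss_of_maximal`). The proof is the same `L³` argument
(planner ns-idea-5 g2 / p591554): the cube `∫|u(t)|³` is invariant along the in-window DSS orbit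
(`lintegral_cube_windowedDss_iterate`), bounded on the fundamental period `[0, T − T/c²]` by Tao's class, hence
`sup_{[0,T)} ‖u(t)‖₃ < ∞`, and the tree's discharged `L^∞_t L³_x` criterion
(`hasSmoothExtensionPast_of_eLpNorm_three_bounded_holds`, Seregin 2012 / Escauriaza–Seregin–Šverák 2003) extends the
solution past `T`, against maximality. The all-times hypothesis is the special case
`windowedDss_of_isDiscretelySelfSimilar`.

HONEST FRAMING: exclusion of one blow-up geometry by a known criterion; the LOCALLY-in-space DSS blow-up (|y|⁻¹ tail
glued to a finite-energy exterior) is untouched; the crux stmt-22866, the residual stmt-1574 and NS regularity stay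
open; no summit is proved. [cite: Seregin2012CMP, Thm 1.1; EscauriazaSereginSverak2003, Thms 1.3–1.4]
-/

-- the problem directory repeats the summit name (`NavierStokesRegularity/NavierStokesRegularity`)
set_option linter.dupNamespace false

noncomputable section

open Set MeasureTheory
open scoped ENNReal NNReal
open Literature.Analysis.FluidPDE

namespace Summit.NavierStokesRegularity.NavierStokesRegularity.Theorems

namespace ProductionEfficiencyDecay

open Summit.NavierStokesRegularity.NavierStokesRegularity.Theorems.RungReynoldsOne (stub_taoCover)

/-- **`L³` cube is constant along in-window DSS orbits**: if `u(T + s) = c • u(T + c²s)(c •·)` for all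
`s ∈ [−T/c², 0)` (`c > 1`), then for every `τ₀ ∈ (0, T]` and `k : ℕ`,
`∫|u(T − τ₀ (c²)⁻¹^k)|³ = ∫|u(T − τ₀)|³`. [folklore] -/
theorem lintegral_cube_windowedDss_iterate {c T : ℝ} (hc : 1 < c)
    {u : ℝ → EuclideanSpace ℝ (Fin 3) → EuclideanSpace ℝ (Fin 3)}
    (hw : ∀ s : ℝ, -(T / c ^ 2) ≤ s → s < 0 → ∀ x, u (T + s) x = c • u (T + c ^ 2 * s) (c • x))
    {τ₀ : ℝ} (hτ₀ : 0 < τ₀) (hτ₀T : τ₀ ≤ T) (k : ℕ) :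
    ∫⁻ x, ‖u (T - τ₀ * (c ^ 2)⁻¹ ^ k) x‖ₑ ^ 3 = ∫⁻ x, ‖u (T - τ₀) x‖ₑ ^ 3 := by
  have hc0 : 0 < c := one_pos.trans hc
  have hy0 : 0 < c ^ 2 := by positivity
  have hq0 : 0 < (c ^ 2)⁻¹ := by positivity
  have hq1 : (c ^ 2)⁻¹ ≤ 1 := inv_le_one_of_one_le₀ (by nlinarith)
  -- one in-window step
  have hstep : ∀ s : ℝ, -(T / c ^ 2) ≤ s → s < 0 →
      ∫⁻ x, ‖u (T + s) x‖ₑ ^ 3 = ∫⁻ x, ‖u (T + c ^ 2 * s) x‖ₑ ^ 3 := by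
    intro s hs1 hs2
    have hc3 : ‖c‖ₑ ^ 3 = ENNReal.ofReal (c ^ 3) := by
      rw [Real.enorm_eq_ofReal_abs, ← ENNReal.ofReal_pow (abs_nonneg c), abs_of_pos hc0]
    calc ∫⁻ x, ‖u (T + s) x‖ₑ ^ 3 = ∫⁻ x, ‖c‖ₑ ^ 3 * ‖u (T + c ^ 2 * s) (c • x)‖ₑ ^ 3 :=
          lintegral_congr fun x => by rw [hw s hs1 hs2 x, enorm_smul, mul_pow]
      _ = ‖c‖ₑ ^ 3 * ∫⁻ x, ‖u (T + c ^ 2 * s) (c • x)‖ₑ ^ 3 :=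
          lintegral_const_mul' _ _ (by simp)
      _ = ‖c‖ₑ ^ 3 * (ENNReal.ofReal ((c ^ 3)⁻¹) * ∫⁻ y, ‖u (T + c ^ 2 * s) y‖ₑ ^ 3) := by
          rw [lintegral_comp_smul_fin3 (fun y => ‖u (T + c ^ 2 * s) y‖ₑ ^ 3) hc0]
      _ = ∫⁻ y, ‖u (T + c ^ 2 * s) y‖ₑ ^ 3 := by
          rw [← mul_assoc, hc3, ← ENNReal.ofReal_mul (by positivity),
            mul_inv_cancel₀ (by positivity), ENNReal.ofReal_one, one_mul]
  induction k with
  | zero => simp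
  | succ k ih =>
      -- the step from `T − τ₀ q^k` to `T − τ₀ q^(k+1)` stays inside the window
      have hqk : (c ^ 2)⁻¹ ^ k ≤ 1 := pow_le_one₀ hq0.le hq1
      have hs1 : -(T / c ^ 2) ≤ -(τ₀ * (c ^ 2)⁻¹ ^ (k + 1)) := by
        rw [neg_le_neg_iff, pow_succ, div_eq_mul_inv]
        have : τ₀ * (c ^ 2)⁻¹ ^ k ≤ T := by nlinarith
        calc τ₀ * ((c ^ 2)⁻¹ ^ k * (c ^ 2)⁻¹) = τ₀ * (c ^ 2)⁻¹ ^ k * (c ^ 2)⁻¹ := by ring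
          _ ≤ T * (c ^ 2)⁻¹ := mul_le_mul_of_nonneg_right this hq0.le
      have hs2 : -(τ₀ * (c ^ 2)⁻¹ ^ (k + 1)) < 0 := by
        have : 0 < τ₀ * (c ^ 2)⁻¹ ^ (k + 1) := by positivity
        linarith
      have h := hstep _ hs1 hs2
      have e1 : T + -(τ₀ * (c ^ 2)⁻¹ ^ (k + 1)) = T - τ₀ * (c ^ 2)⁻¹ ^ (k + 1) := by ring
      have e2 : T + c ^ 2 * -(τ₀ * (c ^ 2)⁻¹ ^ (k + 1)) = T - τ₀ * (c ^ 2)⁻¹ ^ k := by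
        have hcq : c ^ 2 * (c ^ 2)⁻¹ = 1 := mul_inv_cancel₀ hy0.ne'
        calc T + c ^ 2 * -(τ₀ * (c ^ 2)⁻¹ ^ (k + 1))
            = T - τ₀ * (c ^ 2)⁻¹ ^ k * (c ^ 2 * (c ^ 2)⁻¹) := by ring
          _ = T - τ₀ * (c ^ 2)⁻¹ ^ k := by rw [hcq, mul_one]
      rw [e1, e2] at h
      rw [h, ih]

/-- **No maximal Leray–Hopf blow-up is discretely self-similar on its past window.** A maximal smooth solution of
unforced Navier–Stokes on `ℝ³ × [0,T)` (`ν, T > 0`), Leray–Hopf from its rapidly decaying datum, does NOT satisfy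
`u(T + s, x) = c • u(T + c²s, c x)` for all `s ∈ [−T/c², 0)` and all `x`, for any `c > 1`: the `L³` norm would be
bounded on `[0,T)` (constant along in-window DSS orbits, bounded on the fundamental period by Tao's class) and the
discharged `L^∞_t L³_x` criterion would extend the solution past `T`. [cite: Seregin2012CMP, Thm 1.1] -/
theorem not_windowedDss_of_maximal {ν T : ℝ} (hν : 0 < ν) (hT : 0 < T)
    {u : ℝ → EuclideanSpace ℝ (Fin 3) → EuclideanSpace ℝ (Fin 3)} {p : ℝ → EuclideanSpace ℝ (Fin 3) → ℝ}
    (hmax : IsMaximalSmoothSolution ν 0 u p T) (hLH : IsLerayHopfOn T ν 0 (u 0) u)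
    (hdec : HasRapidSpatialDecay (u 0)) {c : ℝ} (hc : 1 < c) :
    ¬ (∀ s : ℝ, -(T / c ^ 2) ≤ s → s < 0 → ∀ x, u (T + s) x = c • u (T + c ^ 2 * s) (c • x)) := by
  intro hw
  have hy1 : 1 < c ^ 2 := by nlinarith
  have hy0 : 0 < c ^ 2 := by positivity
  -- the closed sub-slab `[0, T']`, `T' = T (1 - c⁻²)`
  set T' : ℝ := T - T / c ^ 2 with hT'def
  have hT'pos : 0 < T' := by
    rw [hT'def]
    have : T / c ^ 2 < T := by rw [div_lt_iff₀ hy0]; nlinarith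
    linarith
  have hT'lt : T' < T := by
    rw [hT'def]; have : 0 < T / c ^ 2 := by positivity
    linarith
  obtain ⟨q, hcl, hB, -, -⟩ := stub_taoCover hν hT hmax.1 hLH hdec (T' := T') ⟨hT'pos, hT'lt⟩
  obtain ⟨B₀, hB₀0, hB₀⟩ := exists_forall_norm_le_of_hasBoundedSobolevNormsOn hcl hB
  -- uniform cube bound on the sub-slab: `∫|u|³ ≤ B₀ · 2E₀`
  set E2 : ℝ≥0∞ := ENNReal.ofReal (2 * VectorCalculus.kineticEnergy (u 0)) with hE2
  set J : ℝ≥0∞ := ENNReal.ofReal B₀ * E2 with hJdef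
  have hJtop : J ≠ ⊤ := ENNReal.mul_ne_top ENNReal.ofReal_ne_top ENNReal.ofReal_ne_top
  have hcube : ∀ s ∈ Icc 0 T', ∫⁻ x, ‖u s x‖ₑ ^ 3 ≤ J := by
    intro s hs
    have hsT : s ∈ Icc 0 T := ⟨hs.1, hs.2.trans hT'lt.le⟩
    calc ∫⁻ x, ‖u s x‖ₑ ^ 3 ≤ ∫⁻ x, ENNReal.ofReal B₀ * ‖u s x‖ₑ ^ 2 := by
          refine lintegral_mono fun x => ?_
          rw [pow_succ', sq]
          refine mul_le_mul_left ?_ _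
          rw [← ofReal_norm]
          exact ENNReal.ofReal_le_ofReal (hB₀ s hs x)
      _ = ENNReal.ofReal B₀ * ∫⁻ x, ‖u s x‖ₑ ^ 2 := lintegral_const_mul' _ _ ENNReal.ofReal_ne_top
      _ ≤ J := by rw [hJdef]; exact mul_le_mul_right (hLH.lintegral_enorm_sq_le hν.le hsT) _
  -- the cube bound propagates to all of `[0,T)` along in-window DSS orbits
  have hall : ∀ t ∈ Ico 0 T, ∫⁻ x, ‖u t x‖ₑ ^ 3 ≤ J := by
    intro t ht
    by_cases hcase : t ≤ T'
    · exact hcube t ⟨ht.1, hcase⟩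
    push Not at hcase
    have hτ : 0 < T - t := by linarith [ht.2]
    set τ : ℝ := T - t with hτdef
    have hx1 : 1 ≤ T / τ := by rw [le_div_iff₀ hτ]; linarith [ht.1]
    obtain ⟨n, hn1, hn2⟩ := exists_nat_pow_near hx1 hy1
    set τ₀ : ℝ := (c ^ 2) ^ n * τ with hτ₀def
    have hτ₀leT : τ₀ ≤ T := by rw [hτ₀def]; rwa [le_div_iff₀ hτ] at hn1
    have hτ₀gt : T / c ^ 2 < τ₀ := by
      rw [div_lt_iff₀ hy0, hτ₀def]
      rw [div_lt_iff₀ hτ, pow_succ] at hn2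
      nlinarith
    have hτ₀pos : 0 < τ₀ := lt_trans (by positivity) hτ₀gt
    have hs0 : T - τ₀ ∈ Icc 0 T' := ⟨by linarith, by rw [hT'def]; linarith⟩
    have hiter := lintegral_cube_windowedDss_iterate hc hw hτ₀pos hτ₀leT n
    have harg : T - τ₀ * (c ^ 2)⁻¹ ^ n = t := by
      rw [hτ₀def, hτdef, inv_pow]; field_simp; ring
    rw [harg] at hiter
    rw [hiter]
    exact hcube _ hs0
  -- hence `sup_{[0,T)} ‖u(t)‖₃ < ∞`, and the `L³` criterion extends the solution past `T`
  have h3 : ∀ t ∈ Ico 0 T, eLpNorm (u t) 3 volume ≤ J ^ (1 / 3 : ℝ) := by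
    intro t ht
    rw [eLpNorm_eq_lintegral_rpow_enorm_toReal (by norm_num : (3 : ℝ≥0∞) ≠ 0) (by norm_num),
      ENNReal.toReal_ofNat]
    refine ENNReal.rpow_le_rpow ?_ (by norm_num)
    refine le_trans (le_of_eq (lintegral_congr fun x => ?_)) (hall t ht)
    rw [← ENNReal.rpow_natCast]; norm_num
  have hsup : (⨆ t ∈ Ico 0 T, eLpNorm (u t) 3 volume) < ⊤ := by
    refine lt_of_le_of_lt (iSup₂_le h3) ?_
    exact ENNReal.rpow_lt_top_of_nonneg (by norm_num) hJtop
  exact hmax.2 (hasSmoothExtensionPast_of_eLpNorm_three_bounded_holds ν T hν hT u p hmax.1 hLH hdec hsup)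

/-- The tree's all-times relation `IsDiscretelySelfSimilar c (fun s x => u (T + s) x)` implies the windowed one, so
`not_windowedDss_of_maximal` generalises `not_isDiscretelySelfSimilar_of_maximal` (p591554). [folklore] -/
theorem windowedDss_of_isDiscretelySelfSimilar {c T : ℝ}
    {u : ℝ → EuclideanSpace ℝ (Fin 3) → EuclideanSpace ℝ (Fin 3)}
    (h : IsDiscretelySelfSimilar c (fun s x => u (T + s) x)) :
    ∀ s : ℝ, -(T / c ^ 2) ≤ s → s < 0 → ∀ x, u (T + s) x = c • u (T + c ^ 2 * s) (c • x) := by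
  intro s _ _ x
  have h1 := congrFun (congrFun h s) x
  rw [nsRescale_apply] at h1
  exact h1.symm

end ProductionEfficiencyDecay

end Summit.NavierStokesRegularity.NavierStokesRegularity.Theorems

end
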